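import Literature.NumberTheory.LFunctions.KMVMollifierDiagonalMainTerm
import HarnessLib

/-!
# The local factors behind the `X²` kernel form: `τ(k)W(k)·1_{(k,n)=1} = ((μ/id) ∗ (μ/id)) ∗ h_n`

Supports stmt-Parity-20343 (`PrimeLevelFamEdge.BeyondDiagonalBeatsQuarter`, K_B; line
`diagonal_kernel_split`, registered stub `stub_kernelFormXSq` — the q-free kernel asymptotics of the KMV
second mollified moment at the profile `X²`). A helper; it closes nothing. Namespace
`Summit.Parity.GeneralizedHardyLittlewood.Theorems.BeyondDiagonalBeatsQuarter.KernelFormXSq`.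

With `W(k) = μ(k)/(kψ(k))` (the tree's `KMV2000.MollifierMainTerm.W`, the profile-free part of the KMV
mollifier coefficient divided by `k`), the Selberg coordinates of the `X²` mollifier are the sums
`S(y;n) = Σ_{k ≤ y, (k,n)=1} τ(k)W(k)log²(y/k)` (file `KernelFormXSqCore`). Their summand
`f_n = τ·W·1_{(·,n)=1}` (`copTauW n`) has Dirichlet series `ζ(1+s)⁻²·H_n(s)` with `H_n` absolutely
convergent near `s = 0`; at the level of coefficients this is the factorisation proved here,

  `f_n = (G ∗ G) ∗ h_n`, `G = μ/id` (the tree's `MollifierMainTerm.G`), `h_n = id⁻¹ ∗ id⁻¹ ∗ f_n`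
  (`hloc n`; `copTauW_eq_G_mul_G_mul_hloc`),

together with the values of the multiplicative function `h_n` at prime powers
(`hloc_apply_prime_pow`): `h_n(p^j) = (j+1)p^{−j}` if `p ∣ n`, `= (p+1+j−jp)/((p+1)p^j)` if `p ∤ n`
(so `h_n(p) = 2/(p(p+1))` for `p ∤ n`: the cancellation that makes `Σ|h_n| < ∞`), and the pointwise
majorants `|h_n(m)| ≤ τ(m)/m` (`abs_hloc_le`) and, for squarefree `u`,
`|h_n(u)| ≤ τ(u)·gcd(u,n)/u²` (`abs_hloc_squarefree_le`). Everything here is PROVED; the three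
definitions (`copInd`, `copTauW`, `hloc`) are bookkeeping abbreviations with bodies.

## References
* E. Kowalski, P. Michel, J. VanderKam, J. reine angew. Math. 526 (2000), §5 (21)–(23), Prop. 5.1
  p. 18 (the Dirichlet-series factorisation `ν(s)/ζ²` of the diagonal second moment; here at the
  profile `X²`, in real variables). [cite: KowalskiMichelVanderKam2000, Prop. 5.1 — derivation]
«The programme SEARCHES and TYPES; no claim about Landau–Siegel zeros, Theorems 1–2 of
arXiv:2211.02515 or a repaired Margin232 until a kernel theorem says so.»
-/

noncomputable section

open scoped Real ArithmeticFunction.Moebius ArithmeticFunction.sigma ArithmeticFunction.zeta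
open Finset ArithmeticFunction

namespace Summit.Parity.GeneralizedHardyLittlewood.Theorems.BeyondDiagonalBeatsQuarter.KernelFormXSq

open Literature.NumberTheory.LFunctions Literature.NumberTheory.LFunctions.KMV2000
open MollifierMainTerm (W G invA)

/-! ### The tree's `invA`, `G`, `W` at prime powers -/

/-- Unfolding `invA n = n⁻¹`. [folklore] -/
@[simp] theorem invA_apply' (n : ℕ) : invA n = (n : ℝ)⁻¹ := rfl

/-- `n ↦ n⁻¹` is multiplicative. [folklore] -/
theorem isMultiplicative_invA' : IsMultiplicative invA := by
  refine ⟨by simp, fun {m n} _ ↦ ?_⟩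
  simp [mul_comm]

/-- Unfolding `G n = μ(n)/n`. [folklore] -/
@[simp] theorem G_apply' (n : ℕ) : G n = (μ n : ℝ) * (n : ℝ)⁻¹ := by
  simp [G, pmul_apply, intCoe_apply]

/-- `μ/id` is multiplicative. [folklore] -/
theorem isMultiplicative_G' : IsMultiplicative G :=
  isMultiplicative_moebius.intCast.pmul isMultiplicative_invA'

/-- `μ/(id·ψ)` is multiplicative. [folklore] -/
theorem isMultiplicative_W' : IsMultiplicative W :=
  (isMultiplicative_moebius.intCast.pmul isMultiplicative_invA').pmul
    (IsMultiplicative.prodPrimeFactors _)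

/-- `∏ᵖ_{q ∣ p^i} f(q) = f(p)` for `i ≥ 1`. [folklore] -/
theorem prodPrimeFactors_apply_prime_pow' (f : ℕ → ℝ) {p i : ℕ} (hp : p.Prime) (hi : i ≠ 0) :
    prodPrimeFactors f (p ^ i) = f p := by
  rw [prodPrimeFactors_apply (pow_ne_zero _ hp.ne_zero), Nat.primeFactors_prime_pow hi hp,
    Finset.prod_singleton]

/-- `W(p) = −1/(p+1)`, `W(p^i) = 0` for `i ≥ 2`. [folklore] -/
theorem W_apply_prime_pow' {p i : ℕ} (hp : p.Prime) (hi : i ≠ 0) :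
    W (p ^ i) = if i = 1 then -((p : ℝ) + 1)⁻¹ else 0 := by
  simp only [W, pmul_apply, intCoe_apply, invA_apply', prodPrimeFactors_apply_prime_pow' _ hp hi,
    ArithmeticFunction.moebius_apply_prime_pow hp hi]
  have hp0 : (p : ℝ) ≠ 0 := by exact_mod_cast hp.ne_zero
  split_ifs with h
  · subst h
    push_cast
    field_simp
  · simp

/-- `G(p) = −1/p`. [folklore] -/
theorem G_apply_prime' {p : ℕ} (hp : p.Prime) : G p = -(p : ℝ)⁻¹ := by
  rw [G_apply', ArithmeticFunction.moebius_apply_prime hp]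
  push_cast
  ring

/-- `G(p^i) = 0` for `i ≥ 2`. [folklore] -/
theorem G_apply_prime_pow_of_two_le' {p i : ℕ} (hp : p.Prime) (hi : 2 ≤ i) : G (p ^ i) = 0 := by
  rw [G_apply', ArithmeticFunction.moebius_apply_prime_pow hp (by omega), if_neg (by omega)]
  simp

/-! ### The coprimality indicator and `f_n = τ·W·1_{(·,n)=1}` -/

/-- The indicator of `gcd(k,n) = 1` as a multiplicative arithmetic function of `k`:
`∏_{p ∣ k} [p ∤ n]`. [folklore] -/
def copInd (n : ℕ) : ArithmeticFunction ℝ := prodPrimeFactors fun p ↦ if p ∣ n then 0 else 1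

/-- `copInd n k = [gcd(k,n) = 1]` for `k ≥ 1`. [folklore] -/
theorem copInd_apply {n k : ℕ} (hk : k ≠ 0) : copInd n k = if k.Coprime n then 1 else 0 := by
  rw [copInd, prodPrimeFactors_apply hk]
  by_cases h : k.Coprime n
  · rw [if_pos h]
    refine Finset.prod_eq_one fun p hp ↦ ?_
    rw [if_neg]
    intro hpn
    have hpk := Nat.dvd_of_mem_primeFactors hp
    exact (Nat.prime_of_mem_primeFactors hp).ne_one
      (Nat.eq_one_of_dvd_coprimes h hpk hpn)
  · rw [if_neg h]
    obtain ⟨p, hp, hpk, hpn⟩ := Nat.Prime.not_coprime_iff_dvd.1 h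
    exact Finset.prod_eq_zero ((Nat.mem_primeFactors_of_ne_zero hk).2 ⟨hp, hpk⟩) (if_pos hpn)

/-- `f_n(k) = τ(k)·W(k)·[gcd(k,n)=1]`, the summand of the Selberg coordinates of the `X²` mollifier
(`W = μ/(id·ψ)`). [cite: KowalskiMichelVanderKam2000, §5 (23) — derivation (bookkeeping abbreviation)] -/
def copTauW (n : ℕ) : ArithmeticFunction ℝ :=
  (((σ 0 : ArithmeticFunction ℕ) : ArithmeticFunction ℝ).pmul W).pmul (copInd n)

/-- Unfolding `f_n(k) = [gcd(k,n)=1]·τ(k)·W(k)`. [folklore] -/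
theorem copTauW_apply (n k : ℕ) :
    copTauW n k = if k.Coprime n then (k.divisors.card : ℝ) * W k else 0 := by
  rcases eq_or_ne k 0 with rfl | hk
  · simp [copTauW]
  · rw [copTauW, pmul_apply, pmul_apply, natCoe_apply, sigma_zero_apply, copInd_apply hk]
    split_ifs <;> simp

/-- `f_n` is multiplicative. [folklore] -/
theorem isMultiplicative_copTauW (n : ℕ) : IsMultiplicative (copTauW n) :=
  (isMultiplicative_sigma.natCast.pmul isMultiplicative_W').pmul (IsMultiplicative.prodPrimeFactors _)

/-- `f_n(p) = −2/(p+1)` if `p ∤ n`, `0` if `p ∣ n`; `f_n(p^i) = 0` for `i ≥ 2`. [folklore] -/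
theorem copTauW_apply_prime_pow {n p i : ℕ} (hp : p.Prime) (hi : i ≠ 0) :
    copTauW n (p ^ i) = if i = 1 ∧ ¬ p ∣ n then -2 * ((p : ℝ) + 1)⁻¹ else 0 := by
  rw [copTauW, pmul_apply, pmul_apply, natCoe_apply, sigma_zero_apply_prime_pow hp,
    W_apply_prime_pow' hp hi, copInd, prodPrimeFactors_apply_prime_pow' _ hp hi]
  by_cases h1 : i = 1
  · subst h1
    by_cases hpn : p ∣ n
    · simp [hpn]
    · simp [hpn]
  · simp [h1]

/-! ### `h_n = id⁻¹ ∗ id⁻¹ ∗ f_n` and the factorisation `f_n = (G ∗ G) ∗ h_n` -/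

/-- `h_n := id⁻¹ ∗ id⁻¹ ∗ f_n`, the coefficients of `H_n(s) = ζ(1+s)²·Σ f_n(k)k^{−s}`
(absolutely convergent near `s = 0`). [cite: KowalskiMichelVanderKam2000, Prop. 5.1 — derivation (bookkeeping abbreviation)] -/
def hloc (n : ℕ) : ArithmeticFunction ℝ := invA * invA * copTauW n

/-- `h_n` is multiplicative. [folklore] -/
theorem isMultiplicative_hloc (n : ℕ) : IsMultiplicative (hloc n) :=
  (isMultiplicative_invA'.mul isMultiplicative_invA').mul (isMultiplicative_copTauW n)

/-- `(μ/id) ∗ id⁻¹ = δ` (Möbius inversion divided by `id`). [folklore] -/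
theorem G_mul_invA : G * invA = 1 := by
  have h1 : IsMultiplicative (1 : ArithmeticFunction ℝ) := isMultiplicative_one
  rw [IsMultiplicative.eq_iff_eq_on_prime_powers _ (isMultiplicative_G'.mul isMultiplicative_invA') _ h1]
  intro p i hp
  rcases Nat.eq_zero_or_pos i with rfl | hi
  · rw [pow_zero, (isMultiplicative_G'.mul isMultiplicative_invA').map_one, h1.map_one]
  obtain ⟨k, rfl⟩ : ∃ k, i = k + 1 := ⟨i - 1, by omega⟩
  rw [one_apply_ne (Nat.one_lt_pow (Nat.succ_ne_zero k) hp.one_lt).ne']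
  rw [mul_apply, Nat.sum_divisorsAntidiagonal fun a b ↦ G a * invA b, Nat.divisors_prime_pow hp,
    Finset.sum_map]
  simp only [Function.Embedding.coeFn_mk]
  have hdiv : ∀ j ∈ Finset.range (k + 1 + 1), p ^ (k + 1) / p ^ j = p ^ (k + 1 - j) :=
    fun j hj ↦ Nat.pow_div (by simpa [Nat.lt_succ_iff] using hj) hp.pos
  rw [Finset.sum_congr rfl fun j hj ↦ by rw [hdiv j hj], Finset.sum_range_succ',
    Finset.sum_range_succ']
  have hrest : ∑ j ∈ Finset.range k, G (p ^ (j + 1 + 1)) * invA (p ^ (k + 1 - (j + 1 + 1))) = 0 :=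
    Finset.sum_eq_zero fun j _ ↦ by rw [G_apply_prime_pow_of_two_le' hp (by omega), zero_mul]
  rw [hrest, zero_add, pow_zero, isMultiplicative_G'.map_one, one_mul, pow_one, G_apply_prime' hp]
  have e1 : k + 1 - (0 + 1) = k := by omega
  rw [e1, Nat.sub_zero, invA_apply', invA_apply']
  have hp0 : (p : ℝ) ≠ 0 := by exact_mod_cast hp.ne_zero
  push_cast
  rw [pow_succ]
  field_simp
  ring

/-- **The factorisation `f_n = (G ∗ G) ∗ h_n`** (`τW1_{(·,n)=1} = ((μ/id)∗(μ/id)) ∗ h_n`), i.e. at the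
level of Dirichlet series `Σ f_n(k)k^{−s} = ζ(1+s)⁻²H_n(s)`. [cite: KowalskiMichelVanderKam2000, Prop. 5.1 — derivation] -/
theorem copTauW_eq_G_mul_G_mul_hloc (n : ℕ) : copTauW n = G * G * hloc n := by
  rw [hloc, show G * G * (invA * invA * copTauW n) = (G * invA) * (G * invA) * copTauW n by ring,
    G_mul_invA, one_mul, one_mul]


/-! ### The values of `h_n` at prime powers -/

/-- `(id⁻¹ ∗ id⁻¹)(p^j) = (j+1)p^{−j}`. [folklore] -/
theorem invA_mul_invA_apply_prime_pow {p : ℕ} (hp : p.Prime) (j : ℕ) :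
    (invA * invA) (p ^ j) = ((j : ℝ) + 1) * ((p : ℝ) ^ j)⁻¹ := by
  rw [mul_apply, Nat.sum_divisorsAntidiagonal fun a b ↦ invA a * invA b, Nat.divisors_prime_pow hp,
    Finset.sum_map]
  simp only [Function.Embedding.coeFn_mk]
  have : ∀ i ∈ Finset.range (j + 1), invA (p ^ i) * invA (p ^ j / p ^ i) = ((p : ℝ) ^ j)⁻¹ := by
    intro i hi
    have hij : i ≤ j := Nat.lt_succ_iff.mp (Finset.mem_range.mp hi)
    rw [Nat.pow_div hij hp.pos, invA_apply', invA_apply']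
    push_cast
    rw [← mul_inv, ← pow_add, Nat.add_sub_cancel' hij]
  rw [Finset.sum_congr rfl this, Finset.sum_const, Finset.card_range, nsmul_eq_mul]
  push_cast
  ring

/-- `f_n(p) = −2/(p+1)` if `p ∤ n`, `0` if `p ∣ n`. [folklore] -/
theorem copTauW_apply_prime {n p : ℕ} (hp : p.Prime) :
    copTauW n p = if p ∣ n then 0 else -2 * ((p : ℝ) + 1)⁻¹ := by
  have h := copTauW_apply_prime_pow (n := n) (i := 1) hp one_ne_zero
  rw [pow_one] at h
  rw [h]
  by_cases hpn : p ∣ n <;> simp [hpn]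

/-- `h_n(p^{k+1}) = (id⁻¹∗id⁻¹)(p^{k+1}) + (id⁻¹∗id⁻¹)(p^k)·f_n(p)` (the terms `f_n(p^i)`, `i ≥ 2`,
vanish). [folklore] -/
theorem hloc_apply_prime_pow_succ {n p : ℕ} (hp : p.Prime) (k : ℕ) :
    hloc n (p ^ (k + 1)) = (invA * invA) (p ^ (k + 1)) + (invA * invA) (p ^ k) * copTauW n p := by
  rw [hloc, mul_apply, Nat.sum_divisorsAntidiagonal' fun a b ↦ (invA * invA) a * copTauW n b,
    Nat.divisors_prime_pow hp, Finset.sum_map]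
  simp only [Function.Embedding.coeFn_mk]
  have hdiv : ∀ j ∈ Finset.range (k + 1 + 1), p ^ (k + 1) / p ^ j = p ^ (k + 1 - j) :=
    fun j hj ↦ Nat.pow_div (by simpa [Nat.lt_succ_iff] using hj) hp.pos
  rw [Finset.sum_congr rfl fun j hj ↦ by rw [hdiv j hj], Finset.sum_range_succ',
    Finset.sum_range_succ']
  have hrest : ∑ j ∈ Finset.range k,
      (invA * invA) (p ^ (k + 1 - (j + 1 + 1))) * copTauW n (p ^ (j + 1 + 1)) = 0 :=
    Finset.sum_eq_zero fun j _ ↦ by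
      rw [copTauW_apply_prime_pow hp (by omega), if_neg (by omega), mul_zero]
  rw [hrest, zero_add, pow_zero, (isMultiplicative_copTauW n).map_one, mul_one, pow_one]
  have e1 : k + 1 - (0 + 1) = k := by omega
  rw [e1, Nat.sub_zero, add_comm]

/-- **`h_n` at prime powers**: `h_n(p^j) = (j+1)p^{−j}` if `p ∣ n`, and
`h_n(p^j) = (p + 1 + j − jp)/((p+1)p^j)` if `p ∤ n` (so `h_n(p) = 2/(p(p+1))`).
[cite: KowalskiMichelVanderKam2000, Prop. 5.1 — derivation (local factors of ν(s))] -/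
theorem hloc_apply_prime_pow {n p : ℕ} (hp : p.Prime) (j : ℕ) :
    hloc n (p ^ j) = if p ∣ n then ((j : ℝ) + 1) * ((p : ℝ) ^ j)⁻¹
      else ((p : ℝ) + 1 + j - j * p) / (((p : ℝ) + 1) * (p : ℝ) ^ j) := by
  have hp0 : (p : ℝ) ≠ 0 := by exact_mod_cast hp.ne_zero
  have hp1 : (p : ℝ) + 1 ≠ 0 := by positivity
  rcases j with _ | k
  · rw [pow_zero, (isMultiplicative_hloc n).map_one]
    split_ifs
    · simp
    · simp only [Nat.cast_zero, add_zero, zero_mul, sub_zero, pow_zero, mul_one, div_self hp1]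
  · rw [hloc_apply_prime_pow_succ hp k, invA_mul_invA_apply_prime_pow hp,
      invA_mul_invA_apply_prime_pow hp, copTauW_apply_prime hp]
    by_cases hpn : p ∣ n
    · rw [if_pos hpn, if_pos hpn, mul_zero, add_zero]
    · rw [if_neg hpn, if_neg hpn]
      push_cast
      rw [pow_succ]
      field_simp
      ring

/-- `|h_n(p^j)| ≤ (j+1)/p^j` at every prime power. [folklore] -/
theorem abs_hloc_prime_pow_le {n p : ℕ} (hp : p.Prime) (j : ℕ) :
    |hloc n (p ^ j)| ≤ ((j : ℝ) + 1) * ((p : ℝ) ^ j)⁻¹ := by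
  have hp0 : (0 : ℝ) < p := by exact_mod_cast hp.pos
  have hp1 : (1 : ℝ) ≤ p := by exact_mod_cast hp.one_lt.le
  have hpj : (0 : ℝ) < (p : ℝ) ^ j := by positivity
  rw [hloc_apply_prime_pow hp]
  split_ifs with hpn
  · rw [abs_of_nonneg (by positivity)]
  · rw [abs_div, abs_of_pos (by positivity : (0 : ℝ) < ((p : ℝ) + 1) * (p : ℝ) ^ j),
      div_le_iff₀ (by positivity), abs_le]
    constructor
    · have : ((j : ℝ) + 1) * ((p : ℝ) ^ j)⁻¹ * (((p : ℝ) + 1) * (p : ℝ) ^ j) = (j + 1) * (p + 1) := by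
        field_simp
      rw [this]; nlinarith
    · have : ((j : ℝ) + 1) * ((p : ℝ) ^ j)⁻¹ * (((p : ℝ) + 1) * (p : ℝ) ^ j) = (j + 1) * (p + 1) := by
        field_simp
      rw [this]; nlinarith

/-- `|h_n(p)| ≤ 2·gcd(n,p)/p²` (`= 2/(p(p+1)) ≤ 2/p²` if `p ∤ n`, `= 2/p` if `p ∣ n`). [folklore] -/
theorem abs_hloc_prime_le {n p : ℕ} (hp : p.Prime) :
    |hloc n p| ≤ 2 * (Nat.gcd n p : ℝ) / (p : ℝ) ^ 2 := by
  have hp0 : (0 : ℝ) < p := by exact_mod_cast hp.pos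
  have h := hloc_apply_prime_pow (n := n) hp 1
  rw [pow_one] at h
  rw [h]
  by_cases hpn : p ∣ n
  · rw [if_pos hpn, Nat.gcd_eq_right hpn, abs_of_nonneg (by positivity)]
    push_cast
    rw [pow_one, pow_two, ← div_eq_mul_inv]
    field_simp
    norm_num
  · rw [if_neg hpn, (Nat.coprime_comm.1 ((Nat.Prime.coprime_iff_not_dvd hp).2 hpn)).gcd_eq_one]
    push_cast
    rw [show ((p : ℝ) + 1 + 1 - 1 * p) = 2 by ring, pow_one, abs_of_nonneg (by positivity),
      div_le_div_iff₀ (by positivity) (by positivity)]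
    nlinarith

/-! ### Pointwise majorants -/

/-- `τ(p^k) = k + 1`. [folklore] -/
theorem card_divisors_prime_pow' {p : ℕ} (hp : p.Prime) (k : ℕ) :
    ((p ^ k).divisors.card : ℝ) = k + 1 := by
  rw [← sigma_zero_apply, sigma_zero_apply_prime_pow hp]; push_cast; ring

/-- **`|h_n(m)| ≤ τ(m)/m`** for `m ≥ 1`. [folklore] -/
theorem abs_hloc_le (n : ℕ) {m : ℕ} (hm : m ≠ 0) : |hloc n m| ≤ (m.divisors.card : ℝ) / m := by
  induction m using Nat.recOnPosPrimePosCoprime with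
  | zero => exact absurd rfl hm
  | one => rw [(isMultiplicative_hloc n).map_one]; simp
  | prime_pow p k hp hk =>
    rw [card_divisors_prime_pow' hp, div_eq_mul_inv]
    push_cast
    exact abs_hloc_prime_pow_le hp k
  | coprime a b ha hb hab iha ihb =>
    have ha0 : a ≠ 0 := by omega
    have hb0 : b ≠ 0 := by omega
    rw [(isMultiplicative_hloc n).map_mul_of_coprime hab, Nat.Coprime.card_divisors_mul hab, abs_mul]
    push_cast
    rw [show ((a.divisors.card : ℝ) * b.divisors.card) / ((a : ℝ) * b) =
        (a.divisors.card / a) * (b.divisors.card / b) by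
      field_simp]
    exact mul_le_mul (iha ha0) (ihb hb0) (abs_nonneg _) (by positivity)

/-- **`|h_n(u)| ≤ τ(u)·gcd(n,u)/u²`** for squarefree `u`. [folklore] -/
theorem abs_hloc_squarefree_le (n : ℕ) {u : ℕ} (hu : Squarefree u) :
    |hloc n u| ≤ (u.divisors.card : ℝ) * (Nat.gcd n u : ℝ) / (u : ℝ) ^ 2 := by
  have hu0 : u ≠ 0 := hu.ne_zero
  induction u using Nat.recOnPosPrimePosCoprime with
  | zero => exact absurd rfl hu0
  | one => rw [(isMultiplicative_hloc n).map_one]; simp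
  | prime_pow p k hp hk =>
    have hk1 : k = 1 := ((Nat.squarefree_pow_iff hp.ne_one (by omega)).1 hu).2
    subst hk1
    rw [pow_one] at *
    rw [show ((p.divisors.card : ℕ) : ℝ) = 2 by
      rw [← sigma_zero_apply, ← pow_one p, sigma_zero_apply_prime_pow hp]; norm_num]
    exact abs_hloc_prime_le hp
  | coprime a b ha hb hab iha ihb =>
    have ha0 : a ≠ 0 := by omega
    have hb0 : b ≠ 0 := by omega
    have hsa : Squarefree a := hu.of_mul_left
    have hsb : Squarefree b := hu.of_mul_right
    rw [(isMultiplicative_hloc n).map_mul_of_coprime hab, Nat.Coprime.card_divisors_mul hab, abs_mul,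
      Nat.Coprime.gcd_mul n hab]
    push_cast
    rw [show ((a.divisors.card : ℝ) * b.divisors.card) * ((Nat.gcd n a : ℝ) * (Nat.gcd n b)) /
        ((a : ℝ) * b) ^ 2 =
        (a.divisors.card * (Nat.gcd n a) / (a : ℝ) ^ 2) * (b.divisors.card * (Nat.gcd n b) / (b : ℝ) ^ 2) by
      field_simp]
    exact mul_le_mul (iha hsa ha0) (ihb hsb hb0) (abs_nonneg _) (by positivity)
end Summit.Parity.GeneralizedHardyLittlewood.Theorems.BeyondDiagonalBeatsQuarter.KernelFormXSq
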